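import Summits.KontsevichZagierPeriods.Zeta5Search.SymRaySecondCertificate
import HarnessLib

/-!
# The symmetric-ray SECOND-partner contiguity identity, II: transfer to the canonical coefficients (gen-1 g14)

HONEST FRAMING: systematic search; no irrationality claim unless certified.

OUR work (Summit side), gen-1 (D2 lane) seat g14. The kernel-certified identity of `SymRaySecondCertificate`
(`gosper_second_symray`) is TRANSFERRED to the canonical coefficients exactly as in `SymRayContigTransfer` /
`SymRayContigRelations` (P1): for `X ∈ {U, W, V}` and `n ≥ 1`,
`κ₂(n)·X(b''_n) = α₂(n)X(b_n) + β₂(n)X(b_{n+1}) + γ₂(n)X(b_{n+2})` (`ray_second_U/W/V`; `bRay'' n = b_n + 2e₁`,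
`bRay''_eq_update`; `κ₂(n) > 0`, `secKa_pos`).  Together with the partner relation (`ray_contiguity_U/W/V`) and the ray
recurrence this puts the full 3-frame `{[1],[y],[y²]}` of every level `3n` into the ray frame `{r_n, r_{n+1}, r_{n+2}}`
(memo `HOME/pub-zeta5-gen-1/D2-FRAME-g14.md`).
-/
noncomputable section

open Finset Polynomial

namespace Summit.KontsevichZagierPeriods.Zeta5Search.SymRay

open Summit.KontsevichZagierPeriods.Zeta5Search.DualSeries
open Summit.KontsevichZagierPeriods.Zeta5Search.WedgeDictionary
open Summit.KontsevichZagierPeriods.Zeta5Search.PolyReflect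
open Literature.NumberTheory.Transcendental
open Literature.NumberTheory.Transcendental.BallRivoal (pfEval pf_unique poch_pos harm pochPoly eval_pochPoly)
open Literature.NumberTheory.Irrationality.CressonFischlerRivoal2008 (exists_pf_data)

/-! ### The second partner `b'' = b + 2e₁`: box facts and evaluation of its canonical data -/

/-- The second partner `b''_n = b_n + 2e₁ = (3n; n+2, n⁶)`, as an update of the partner `b'_n`. -/
def bRay'' (n : ℕ) : ℕ → ℤ := Function.update (bRay' n) 1 (bRay' n 1 + 1)

/-- `(b')₁ = n + 1`. -/
theorem bRay'_one (n : ℕ) : bRay' n 1 = (n : ℤ) + 1 := by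
  rw [bRay', Function.update_self, bRay_one]

/-- `(b'')₀ = 3n`. -/
theorem bRay''_zero (n : ℕ) : bRay'' n 0 = 3 * (n : ℤ) := by
  rw [bRay'', Function.update_of_ne (by norm_num), bRay'_zero]

/-- `(b'')₀ = 3n` as a natural number. -/
theorem bRay''_zero_toNat (n : ℕ) : (bRay'' n 0).toNat = 3 * n := by
  rw [bRay''_zero, show (3 * (n : ℤ)) = ((3 * n : ℕ) : ℤ) by push_cast; ring, Int.toNat_natCast]

/-- The second partner as an update at index `0 + 1` (the form the library lemmas use). -/
theorem bRay''_eq (n : ℕ) : bRay'' n = Function.update (bRay' n) (0 + 1) (bRay' n (0 + 1) + 1) := rfl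

/-- `d(b'_n) = 2n − 1`. -/
theorem dOf_bRay' (n : ℕ) : dOf (bRay' n) = 2 * (n : ℤ) - 1 := by
  simp [dOf, bRay', bRay, sum_range_succ, Function.update_apply]
  ring

/-- For `n ≥ 1` the second partner lies in the box with `Σ_j b''_j ≤ 3b''₀ + 1`. -/
theorem box_bRay'' (n : ℕ) (hn : 1 ≤ n) :
    InBox (bRay'' n) ∧ ∑ j ∈ range 7, bRay'' n (j + 1) ≤ 3 * bRay'' n 0 + 1 := by
  rw [bRay''_eq]
  refine box_update (bRay' n) (box_bRay' n).1 ?_ (by simp) ?_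
  · rw [dOf_bRay']; omega
  · rw [Nat.zero_add, bRay'_one, bRay'_zero]; omega

/-- The canonical data of the second partner ARE partial-fraction data of `R''_n` (`n ≥ 1`). -/
theorem isPFData_ray'' (n : ℕ) (hn : 1 ≤ n) : IsPFData (bRay'' n) (pfData (bRay'' n)) :=
  isPFData_pfData (Classical.choose_spec (exists_isPFData (bRay'' n) (box_bRay'' n hn).1 (box_bRay'' n hn).2))

/-- `numPoly_{b''}(t+1) = (2t+3n+2)((t+1)_n (t+2n+2)_n)⁷ · (t+n+1)(t+2n+1) · (t+n+2)(t+2n)`. -/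
theorem eval_numPoly_bRay'' (n : ℕ) (t : ℚ) :
    ((numPoly (bRay'' n)).comp (X + C 1)).eval t =
      (2 * t + 3 * n + 2) * (BallRivoal.poch (t + 1) n * BallRivoal.poch (t + 2 * n + 2) n) ^ 7 *
        ((t + n + 1) * (t + 2 * n + 1)) * ((t + n + 2) * (t + 2 * n)) := by
  have e1 : bRay' n (0 + 1) = (n : ℤ) + 1 := bRay'_one n
  rw [bRay''_eq, numPoly_update (bRay' n) (i := 0) (by simp) (by rw [e1]; positivity), mul_comp, eval_mul,
    eval_numPoly_bRay', e1, bRay'_zero]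
  simp only [mul_comp, add_comp, X_comp, C_comp, eval_mul, eval_add, eval_X, eval_C]
  push_cast; ring

/-- Evaluation of the canonical data of the second partner off the poles (`n ≥ 1`). -/
theorem pfEval_ray'' (n : ℕ) (hn : 1 ≤ n) (t : ℚ) (ht : ∀ p, p ≤ 3 * n → t + p + 1 ≠ 0) :
    pfEval (3 * n) 6 (pfData (bRay'' n)) t =
      (2 * t + 3 * n + 2) * (BallRivoal.poch (t + 1) n * BallRivoal.poch (t + 2 * n + 2) n) ^ 7 *
          ((t + n + 1) * (t + 2 * n + 1)) * ((t + n + 2) * (t + 2 * n)) /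
        BallRivoal.poch (t + 1) (3 * n + 1) ^ 6 := by
  have h := isPFData_ray'' n hn t (by rw [bRay''_zero_toNat]; exact ht)
  rw [bRay''_zero_toNat, eval_numPoly_bRay''] at h
  exact h

/-- `U(bRay'' m) = Σ_{p ≤ 3m} c''_{4,p}`. -/
theorem coeffU_ray'' (m : ℕ) : coeffU (bRay'' m) = ∑ p ∈ range (3 * m + 1), pfData (bRay'' m) 4 p := by
  rw [coeffU, bRay''_zero_toNat]

/-- `W(bRay'' m) = Σ_{p ≤ 3m} c''_{2,p}`. -/
theorem coeffW_ray'' (m : ℕ) : coeffW (bRay'' m) = ∑ p ∈ range (3 * m + 1), pfData (bRay'' m) 2 p := by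
  rw [coeffW, bRay''_zero_toNat]

/-- `V(bRay'' m) = Σ_{o<6} Σ_{p ≤ 3m} c''_{o,p} H_p^{(o+1)}`. -/
theorem coeffV_ray'' (m : ℕ) :
    coeffV (bRay'' m) = ∑ o ∈ range 6, ∑ p ∈ range (3 * m + 1), pfData (bRay'' m) o p * harm (o + 1) p := by
  rw [coeffV, bRay''_zero_toNat]

/-! ### The certificate `H₂ = y₂·R_n/D₂` as a polynomial over the lattice denominator -/

/-- `H₂·((t+1)_{3n+5})⁷ = y₂(n,t)·(t+1)_n⁸ (t+2n+2)_n (t+n+1)_{n+1} (t+2n+6)_n⁷` as a polynomial in `t`. -/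
def hPolyT2 (n : ℕ) : ℚ[X] :=
  toPolyT ySec n * (pochPoly 1 n ^ 8 * pochPoly (2 * n + 2) n * pochPoly (n + 1) (n + 1) * pochPoly (2 * n + 6) n ^ 7)

/-- Evaluation of `hPolyT2`. -/
theorem eval_hPolyT2 (n : ℕ) (t : ℚ) : (hPolyT2 n).eval t =
    ev2 ySec n t * (BallRivoal.poch (t + 1) n ^ 8 * BallRivoal.poch (t + (2 * n + 2)) n *
      BallRivoal.poch (t + (n + 1)) (n + 1) * BallRivoal.poch (t + (2 * n + 6)) n ^ 7) := by
  simp only [hPolyT2, eval_mul, eval_pow, eval_toPolyT, eval_pochPoly]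

/-- `ySec` has `35` rows. -/
theorem ySec_length : ySec.length = 35 := by decide

/-- `deg hPolyT2 ≤ 17n + 36 (< 7(3n+5) for n ≥ 1)`. -/
theorem natDegree_hPolyT2_le (n : ℕ) : (hPolyT2 n).natDegree ≤ 17 * n + 36 := by
  unfold hPolyT2
  have h0 := natDegree_toPolyT_le ySec (n : ℚ)
  rw [ySec_length] at h0
  have h1 := natDegree_pochPoly_le (1 : ℚ) n
  have h2 := natDegree_pochPoly_le ((2 * n + 2 : ℕ) : ℚ) n
  have h3 := natDegree_pochPoly_le ((n + 1 : ℕ) : ℚ) (n + 1)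
  have h4 := natDegree_pochPoly_le ((2 * n + 6 : ℕ) : ℚ) n
  have e1 : (pochPoly 1 n ^ 8).natDegree ≤ 8 * n := natDegree_pow_le.trans (by omega)
  have e4 : (pochPoly ((2 * n + 6 : ℕ) : ℚ) n ^ 7).natDegree ≤ 7 * n := natDegree_pow_le.trans (by omega)
  push_cast at h2 h3 h4 e4
  refine natDegree_mul_le.trans ?_
  have e5 := natDegree_mul_le (p := pochPoly 1 n ^ 8 * pochPoly (2 * n + 2) n * pochPoly (n + 1) (n + 1))
    (q := pochPoly (2 * (n : ℚ) + 6) n ^ 7)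
  have e6 := natDegree_mul_le (p := pochPoly 1 n ^ 8 * pochPoly (2 * (n : ℚ) + 2) n) (q := pochPoly ((n : ℚ) + 1) (n + 1))
  have e7 := natDegree_mul_le (p := pochPoly (1 : ℚ) n ^ 8) (q := pochPoly (2 * (n : ℚ) + 2) n)
  omega

/-- **Partial fractions of the certificate `H₂` exist** for `n ≥ 1` (lattice poles `−1, …, −(3n+5)` of order `≤ 7`). -/
theorem exists_pf_H2 (n : ℕ) (hn : 1 ≤ n) : ∃ d : ℕ → ℕ → ℚ, ∀ t : ℚ, (∀ p, p ≤ 3 * n + 4 → t + p + 1 ≠ 0) →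
    pfEval (3 * n + 4) 7 d t = (hPolyT2 n).eval t / BallRivoal.poch (t + 1) (3 * n + 5) ^ 7 := by
  have hdeg : (hPolyT2 n).degree < ((7 * (3 * n + 4 + 1) : ℕ) : WithBot ℕ) :=
    (degree_le_of_natDegree_le (natDegree_hPolyT2_le n)).trans_lt (by exact_mod_cast (by omega))
  obtain ⟨d, hd⟩ := exists_pf_data (3 * n + 4) 7 (by norm_num) (hPolyT2 n) hdeg
  exact ⟨d, fun t ht => by rw [hd t ht]⟩

/-- `y₂(n,0) = 0`: the row `t^0` of the certificate is zero, so `H₂(0) = 0`. -/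
theorem ev2_ySec_zero (n : ℚ) : ev2 ySec n 0 = 0 := by
  rw [show ySec = [0] :: (ySecA.tail ++ ySecB) from rfl, ev2_cons]
  simp

/-! ### The six terms of the identity over the common factor `R̄₂` of `SymRayContigTransfer` -/

section terms
variable {n t : ℕ}

/-- `t+n+1`. -/
private theorem m111 : ev2 (lin2 1 1 1) n t = t + n + 1 := by rw [ev2_lin2]; push_cast; ring
/-- `t+n+2`. -/
private theorem m112 : ev2 (lin2 1 1 2) n t = t + n + 2 := by rw [ev2_lin2]; push_cast; ring
/-- `t+2n+j`. -/
private theorem m21 (j : ℤ) : ev2 (lin2 2 1 j) n t = t + 2 * n + j := by rw [ev2_lin2]; push_cast; ring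
/-- `t+3n+j`. -/
private theorem m31 (j : ℤ) : ev2 (lin2 3 1 j) n t = t + 3 * n + j := by rw [ev2_lin2]; push_cast; ring
/-- `2t+3n+j`. -/
private theorem m32 (j : ℤ) : ev2 (lin2 3 2 j) n t = 2 * t + 3 * n + j := by rw [ev2_lin2]; push_cast; ring
/-- `t+1`. -/
private theorem m011 : ev2 (lin2 0 1 1) n t = t + 1 := by rw [ev2_lin2]; push_cast; ring

end terms

/-- `(x)_4`. -/
private theorem qoch_four (x : ℚ) : BallRivoal.poch x 4 = x * (x + 1) * (x + 2) * (x + 3) := by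
  simp [BallRivoal.poch, prod_range_succ]
/-- `(x)_5`. -/
private theorem qoch_five (x : ℚ) : BallRivoal.poch x 5 = x * (x + 1) * (x + 2) * (x + 3) * (x + 4) := by
  simp [BallRivoal.poch, prod_range_succ]

/-- `R''_n = R̄₂·N''·B₂` (`n ≥ 1`). -/
theorem ctermPP (n t : ℕ) (hn : 1 ≤ n) :
    pfEval (3 * n) 6 (pfData (bRay'' n)) t = Rbar2 n t n * (ev2 cNpp n t * ev2 cB2 n t) := by
  have ht : ∀ p, p ≤ 3 * n → (t : ℚ) + p + 1 ≠ 0 := fun p _ => by positivity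
  rw [pfEval_ray'' n hn t ht, poch_ray_split]
  simp only [Rbar2, cNpp, cD2, cB2, ev2_mul2, ev2_pow2, m111, m112, m21, m32, m011]
  have hA : BallRivoal.poch ((t : ℚ) + 1) n ≠ 0 := (poch_pos (by positivity) _).ne'
  have hC : BallRivoal.poch ((t : ℚ) + 2 * n + 2) n ≠ 0 := (poch_pos (by positivity) _).ne'
  have hE : BallRivoal.poch ((t : ℚ) + n + 1) (n + 1) ≠ 0 := (poch_pos (by positivity) _).ne'
  push_cast
  field_simp
  try ring

/-- `H₂(t) = R̄₂·y₂(n,t)·B₂` for partial-fraction data `d` of `H₂`. -/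
theorem ctermH2 (n t : ℕ) (d : ℕ → ℕ → ℚ)
    (hd : ∀ s : ℚ, (∀ p, p ≤ 3 * n + 4 → s + p + 1 ≠ 0) →
      pfEval (3 * n + 4) 7 d s = (hPolyT2 n).eval s / BallRivoal.poch (s + 1) (3 * n + 5) ^ 7) :
    pfEval (3 * n + 4) 7 d t = Rbar2 n t n * (ev2 ySec n t * ev2 cB2 n t) := by
  rw [hd _ (fun p _ => by positivity), eval_hPolyT2]
  set A := BallRivoal.poch ((t : ℚ) + 1) n with hAdef
  set C := BallRivoal.poch ((t : ℚ) + 2 * n + 2) n with hCdef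
  set E := BallRivoal.poch ((t : ℚ) + n + 1) (n + 1) with hEdef
  have eC : BallRivoal.poch ((t : ℚ) + (2 * n + 2)) n = C := by rw [hCdef]; congr 1; ring
  have eE : BallRivoal.poch ((t : ℚ) + (n + 1)) (n + 1) = E := by rw [hEdef]; congr 1; ring
  have e4 : BallRivoal.poch ((t : ℚ) + (2 * n + 6)) n *
      (((t : ℚ) + 2 * n + 2) * ((t : ℚ) + 2 * n + 3) * ((t : ℚ) + 2 * n + 4) * ((t : ℚ) + 2 * n + 5)) =
      C * (((t : ℚ) + 3 * n + 2) * ((t : ℚ) + 3 * n + 3) * ((t : ℚ) + 3 * n + 4) * ((t : ℚ) + 3 * n + 5)) := by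
    have h := poch_split_comm ((t : ℚ) + 2 * n + 2) (a := 4) (b := n) (c := n) (d := 4) (by ring)
    rw [qoch_four, qoch_four, ← hCdef] at h
    have : BallRivoal.poch ((t : ℚ) + (2 * n + 6)) n = BallRivoal.poch ((t : ℚ) + 2 * n + 2 + (4 : ℕ)) n := by
      congr 1; push_cast; ring
    rw [this]; push_cast at h ⊢; linear_combination h
  have e5 : BallRivoal.poch ((t : ℚ) + 1) (3 * n + 5) =
      A * E * C * (((t : ℚ) + 3 * n + 2) * ((t : ℚ) + 3 * n + 3) * ((t : ℚ) + 3 * n + 4) * ((t : ℚ) + 3 * n + 5)) := by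
    rw [show 3 * n + 5 = (3 * n + 1) + 4 by ring, poch_add, poch_ray_split, qoch_four, ← hAdef, ← hCdef, ← hEdef]
    push_cast; ring
  simp only [Rbar2, cB2, ev2_mul2, ev2_pow2, m21, m011]
  rw [← hAdef, ← hCdef, ← hEdef]
  have hA : A ≠ 0 := (poch_pos (by positivity) _).ne'
  have hC : C ≠ 0 := (poch_pos (by positivity) _).ne'
  have hE : E ≠ 0 := (poch_pos (by positivity) _).ne'
  have hv : ((t : ℚ) + 2 * n + 2) * ((t : ℚ) + 2 * n + 3) * ((t : ℚ) + 2 * n + 4) * ((t : ℚ) + 2 * n + 5) ≠ 0 := by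
    positivity
  rw [eC, eE, (eq_div_iff hv).2 e4, e5]
  push_cast
  field_simp

/-- `H₂(t+1) = R̄₂·y₂(n,t+1)·A₂` for partial-fraction data `d` of `H₂`. -/
theorem ctermH2_succ (n t : ℕ) (d : ℕ → ℕ → ℚ)
    (hd : ∀ s : ℚ, (∀ p, p ≤ 3 * n + 4 → s + p + 1 ≠ 0) →
      pfEval (3 * n + 4) 7 d s = (hPolyT2 n).eval s / BallRivoal.poch (s + 1) (3 * n + 5) ^ 7) :
    pfEval (3 * n + 4) 7 d ((t : ℚ) + 1) = Rbar2 n t n * (ev2 ySec n ((t : ℚ) + 1) * ev2 cA2 n t) := by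
  rw [hd _ (fun p _ => by positivity), eval_hPolyT2]
  set A := BallRivoal.poch ((t : ℚ) + 1) n with hAdef
  set C := BallRivoal.poch ((t : ℚ) + 2 * n + 2) n with hCdef
  set E := BallRivoal.poch ((t : ℚ) + n + 1) (n + 1) with hEdef
  have e6 : BallRivoal.poch ((t : ℚ) + 1 + 1) n * ((t : ℚ) + 1) = A * ((t : ℚ) + n + 1) := by
    have h1 := poch_succ_left ((t : ℚ) + 1) n
    have h2 := poch_succ_right ((t : ℚ) + 1) n
    rw [← hAdef] at h2; linear_combination -h1 + h2
  have e7 : BallRivoal.poch ((t : ℚ) + 1 + (2 * n + 2)) n * ((t : ℚ) + 2 * n + 2) = C * ((t : ℚ) + 3 * n + 2) := by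
    have h1 := poch_succ_left ((t : ℚ) + 2 * n + 2) n
    have h2 := poch_succ_right ((t : ℚ) + 2 * n + 2) n
    rw [← hCdef] at h2
    rw [show (t : ℚ) + 1 + (2 * n + 2) = (t : ℚ) + 2 * n + 2 + 1 by ring]
    linear_combination -h1 + h2
  have e8 : BallRivoal.poch ((t : ℚ) + 1 + (n + 1)) (n + 1) * ((t : ℚ) + n + 1) = E * ((t : ℚ) + 2 * n + 2) := by
    have h1 := poch_succ_left ((t : ℚ) + n + 1) (n + 1)
    have h2 := poch_succ_right ((t : ℚ) + n + 1) (n + 1)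
    rw [← hEdef] at h2
    rw [show (t : ℚ) + 1 + (n + 1) = (t : ℚ) + n + 1 + 1 by ring]
    push_cast at h1 h2 ⊢; linear_combination -h1 + h2
  have e9 : BallRivoal.poch ((t : ℚ) + 1 + (2 * n + 6)) n *
      (((t : ℚ) + 2 * n + 2) * ((t : ℚ) + 2 * n + 3) * ((t : ℚ) + 2 * n + 4) * ((t : ℚ) + 2 * n + 5) *
        ((t : ℚ) + 2 * n + 6)) =
      C * (((t : ℚ) + 3 * n + 2) * ((t : ℚ) + 3 * n + 3) * ((t : ℚ) + 3 * n + 4) * ((t : ℚ) + 3 * n + 5) *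
        ((t : ℚ) + 3 * n + 6)) := by
    have h := poch_split_comm ((t : ℚ) + 2 * n + 2) (a := 5) (b := n) (c := n) (d := 5) (by ring)
    rw [qoch_five, qoch_five, ← hCdef] at h
    rw [show (t : ℚ) + 1 + (2 * n + 6) = (t : ℚ) + 2 * n + 2 + ((5 : ℕ) : ℚ) by push_cast; ring]
    push_cast at h ⊢; linear_combination h
  have e10 : BallRivoal.poch ((t : ℚ) + 1 + 1) (3 * n + 5) * ((t : ℚ) + 1) =
      A * E * C * (((t : ℚ) + 3 * n + 2) * ((t : ℚ) + 3 * n + 3) * ((t : ℚ) + 3 * n + 4) * ((t : ℚ) + 3 * n + 5) *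
        ((t : ℚ) + 3 * n + 6)) := by
    have h1 := poch_succ_left ((t : ℚ) + 1) (3 * n + 5)
    have h2 : BallRivoal.poch ((t : ℚ) + 1) (3 * n + 5 + 1) =
        A * E * C * (((t : ℚ) + 3 * n + 2) * ((t : ℚ) + 3 * n + 3) * ((t : ℚ) + 3 * n + 4) * ((t : ℚ) + 3 * n + 5) *
        ((t : ℚ) + 3 * n + 6)) := by
      rw [show 3 * n + 5 + 1 = (3 * n + 1) + 5 by ring, poch_add, poch_ray_split, qoch_five, ← hAdef, ← hCdef, ← hEdef]
      push_cast; ring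
    linear_combination -h1 + h2
  simp only [Rbar2, cA2, ev2_mul2, ev2_pow2, m111, m21, m31, m011]
  rw [← hAdef, ← hCdef, ← hEdef]
  have hA : A ≠ 0 := (poch_pos (by positivity) _).ne'
  have hC : C ≠ 0 := (poch_pos (by positivity) _).ne'
  have hE : E ≠ 0 := (poch_pos (by positivity) _).ne'
  have ht1 : ((t : ℚ) + 1) ≠ 0 := by positivity
  have hv2 : ((t : ℚ) + 2 * n + 2) ≠ 0 := by positivity
  have hu1 : ((t : ℚ) + n + 1) ≠ 0 := by positivity
  have hv : ((t : ℚ) + 2 * n + 2) * ((t : ℚ) + 2 * n + 3) * ((t : ℚ) + 2 * n + 4) * ((t : ℚ) + 2 * n + 5) *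
      ((t : ℚ) + 2 * n + 6) ≠ 0 := by positivity
  rw [(eq_div_iff ht1).2 e6, (eq_div_iff hv2).2 e7, (eq_div_iff hu1).2 e8, (eq_div_iff hv).2 e9,
    (eq_div_iff ht1).2 e10]
  push_cast
  field_simp

/-- **The second-partner identity of the ray at natural arguments** (`n ≥ 1`):
`κ₂R''_n(t) − α₂R_n(t) − β₂R_{n+1}(t) − γ₂R_{n+2}(t) + H₂(t) − H₂(t+1) = 0` for partial-fraction data `d` of `H₂`. -/
theorem second_identity_ray (n t : ℕ) (hn : 1 ≤ n) (d : ℕ → ℕ → ℚ)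
    (hd : ∀ s : ℚ, (∀ p, p ≤ 3 * n + 4 → s + p + 1 ≠ 0) →
      pfEval (3 * n + 4) 7 d s = (hPolyT2 n).eval s / BallRivoal.poch (s + 1) (3 * n + 5) ^ 7) :
    ev1 secKa n * pfEval (3 * n) 6 (pfData (bRay'' n)) t - ev1 secAl n * pfEval (3 * n) 6 (pfData (bRay n)) t
      - ev1 secBe n * pfEval (3 * (n + 1)) 6 (pfData (bRay (n + 1))) t
      - ev1 secGa n * pfEval (3 * (n + 2)) 6 (pfData (bRay (n + 2))) t
      + pfEval (3 * n + 4) 7 d t - pfEval (3 * n + 4) 7 d ((t : ℚ) + 1) = 0 := by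
  rw [ctermPP n t hn, cterm0, cterm1, cterm2, ctermH2 n t d hd, ctermH2_succ n t d hd]
  linear_combination (Rbar2 n t n) * gosper_second_symray n t

/-! ### Transfer to the canonical coefficients (uniqueness of partial fractions) -/

/-- `V(bRay'' m)` is `Vfun` of the canonical data of the second partner. -/
theorem Vfun_ray'' (m : ℕ) : Vfun (3 * m) 6 (pfData (bRay'' m)) = coeffV (bRay'' m) := by
  rw [coeffV_ray'']; rfl

/-- **The combined data of the second-partner identity vanish identically** (`n ≥ 1`). -/
theorem second_data_zero (n : ℕ) (hn : 1 ≤ n) : ∃ d : ℕ → ℕ → ℚ,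
    (∀ s : ℚ, (∀ p, p ≤ 3 * n + 4 → s + p + 1 ≠ 0) →
      pfEval (3 * n + 4) 7 d s = (hPolyT2 n).eval s / BallRivoal.poch (s + 1) (3 * n + 5) ^ 7) ∧
    ∀ o p, o < 7 → p ≤ 3 * (n + 2) →
      comb6 (ev1 secKa n) (-ev1 secAl n) (-ev1 secBe n) (-ev1 secGa n)
        (padData (3 * n) (cut (pfData (bRay'' n)))) (padData (3 * n) (cut (pfData (bRay n))))
        (padData (3 * (n + 1)) (cut (pfData (bRay (n + 1))))) (cut (pfData (bRay (n + 2))))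
        (padData (3 * n + 4) d) (padData (3 * n + 5) (shiftUp d)) o p = 0 := by
  obtain ⟨d, hd⟩ := exists_pf_H2 n hn
  refine ⟨d, hd, fun o p ho hp => data_eq_zero_of_pfEval_zero (3 * (n + 2)) 7 _ (fun t => ?_) ho hp⟩
  rw [pfEval_comb6, pfEval_padData (by omega), pfEval_padData (by omega), pfEval_padData (by omega),
    pfEval_padData (by omega), pfEval_padData (by omega), pfEval_cut, pfEval_cut, pfEval_cut, pfEval_cut,
    show 3 * n + 5 = (3 * n + 4) + 1 by ring, pfEval_shiftUp]
  have h := second_identity_ray n t hn d hd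
  linear_combination h

/-- **Second-partner contiguity for `U`** (`n ≥ 1`): `κ₂U(b''_n) = α₂U(b_n) + β₂U(b_{n+1}) + γ₂U(b_{n+2})`. -/
theorem ray_second_U (n : ℕ) (hn : 1 ≤ n) :
    ev1 secKa n * coeffU (bRay'' n) =
      ev1 secAl n * coeffU (bRay n) + ev1 secBe n * coeffU (bRay (n + 1)) + ev1 secGa n * coeffU (bRay (n + 2)) := by
  obtain ⟨d, _, hz⟩ := second_data_zero n hn
  have h : ∑ p ∈ range (3 * (n + 2) + 1), comb6 (ev1 secKa n) (-ev1 secAl n) (-ev1 secBe n) (-ev1 secGa n)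
      (padData (3 * n) (cut (pfData (bRay'' n)))) (padData (3 * n) (cut (pfData (bRay n))))
      (padData (3 * (n + 1)) (cut (pfData (bRay (n + 1))))) (cut (pfData (bRay (n + 2))))
      (padData (3 * n + 4) d) (padData (3 * n + 5) (shiftUp d)) 4 p = 0 :=
    sum_eq_zero fun p hp => hz 4 p (by norm_num) (Nat.lt_succ_iff.1 (mem_range.1 hp))
  rw [sum_comb6, sum_padData (by omega), sum_padData (by omega), sum_padData (by omega), sum_padData (by omega),
    sum_padData (by omega), sum_cut _ _ (by norm_num), sum_cut _ _ (by norm_num), sum_cut _ _ (by norm_num),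
    sum_cut _ _ (by norm_num), show 3 * n + 5 + 1 = (3 * n + 4) + 2 by ring, sum_shiftUp] at h
  rw [coeffU_ray'', coeffU_ray, coeffU_ray, coeffU_ray]
  linear_combination h

/-- **Second-partner contiguity for `W`** (`n ≥ 1`). -/
theorem ray_second_W (n : ℕ) (hn : 1 ≤ n) :
    ev1 secKa n * coeffW (bRay'' n) =
      ev1 secAl n * coeffW (bRay n) + ev1 secBe n * coeffW (bRay (n + 1)) + ev1 secGa n * coeffW (bRay (n + 2)) := by
  obtain ⟨d, _, hz⟩ := second_data_zero n hn
  have h : ∑ p ∈ range (3 * (n + 2) + 1), comb6 (ev1 secKa n) (-ev1 secAl n) (-ev1 secBe n) (-ev1 secGa n)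
      (padData (3 * n) (cut (pfData (bRay'' n)))) (padData (3 * n) (cut (pfData (bRay n))))
      (padData (3 * (n + 1)) (cut (pfData (bRay (n + 1))))) (cut (pfData (bRay (n + 2))))
      (padData (3 * n + 4) d) (padData (3 * n + 5) (shiftUp d)) 2 p = 0 :=
    sum_eq_zero fun p hp => hz 2 p (by norm_num) (Nat.lt_succ_iff.1 (mem_range.1 hp))
  rw [sum_comb6, sum_padData (by omega), sum_padData (by omega), sum_padData (by omega), sum_padData (by omega),
    sum_padData (by omega), sum_cut _ _ (by norm_num), sum_cut _ _ (by norm_num), sum_cut _ _ (by norm_num),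
    sum_cut _ _ (by norm_num), show 3 * n + 5 + 1 = (3 * n + 4) + 2 by ring, sum_shiftUp] at h
  rw [coeffW_ray'', coeffW_ray, coeffW_ray, coeffW_ray]
  linear_combination h

/-- `H₂(0) = 0`: the second-partner certificate vanishes at `t = 0`. -/
theorem pfEval_H2_zero (n : ℕ) (d : ℕ → ℕ → ℚ)
    (hd : ∀ s : ℚ, (∀ p, p ≤ 3 * n + 4 → s + p + 1 ≠ 0) →
      pfEval (3 * n + 4) 7 d s = (hPolyT2 n).eval s / BallRivoal.poch (s + 1) (3 * n + 5) ^ 7) :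
    pfEval (3 * n + 4) 7 d 0 = 0 := by
  rw [hd 0 (fun p _ => by positivity), eval_hPolyT2, ev2_ySec_zero, zero_mul, zero_div]

/-- **Second-partner contiguity for the constant term `V`** (`n ≥ 1`). -/
theorem ray_second_V (n : ℕ) (hn : 1 ≤ n) :
    ev1 secKa n * coeffV (bRay'' n) =
      ev1 secAl n * coeffV (bRay n) + ev1 secBe n * coeffV (bRay (n + 1)) + ev1 secGa n * coeffV (bRay (n + 2)) := by
  obtain ⟨d, hd, hz⟩ := second_data_zero n hn
  have h := Vfun_eq_zero_of_data (N := 3 * (n + 2)) (K := 7) hz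
  rw [Vfun_comb6, Vfun_padData (by omega), Vfun_padData (by omega), Vfun_padData (by omega), Vfun_padData (by omega),
    Vfun_padData (by omega), Vfun_cut, Vfun_cut, Vfun_cut, Vfun_cut, show 3 * n + 5 = (3 * n + 4) + 1 by ring,
    Vfun_shiftUp, pfEval_H2_zero n d hd, Vfun_ray'', Vfun_ray, Vfun_ray, Vfun_ray] at h
  linear_combination h

/-- `κ₂(n) > 0` for `n ≥ 1` (so the relation determines `X(b'')`). -/
theorem secKa_pos (n : ℕ) (hn : 1 ≤ n) : 0 < ev1 secKa n := by
  have hn' : (0 : ℚ) < n := by exact_mod_cast hn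
  rw [ev1_secKa]
  positivity

/-- The second partner literally as `b_n + 2e₁`. -/
theorem bRay''_eq_update (n : ℕ) : bRay'' n = Function.update (bRay n) 1 (bRay n 1 + 2) := by
  funext j
  by_cases hj : j = 1
  · subst hj; rw [bRay'', Function.update_self, Function.update_self, bRay'_one, bRay_one]; ring
  · rw [bRay'', Function.update_of_ne hj, bRay', Function.update_of_ne hj, Function.update_of_ne hj]

end Summit.KontsevichZagierPeriods.Zeta5Search.SymRay
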